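import Literature.Computability.Complexity.IWAmplification
import Literature.Computability.Complexity.BlockOverwrite
import HarnessLib

/-!
# The Impagliazzo–Wigderson derandomized XOR construction, II: the hybrid argument with advice

Topic `Computability/Complexity`, continuation of `IWAmplification.lean`. This file PROVES the
indistinguishability-preserving property of the generator `σ ↦ (w₀(σ), …, w_{k-1}(σ))`,
`wᵢ(x, y) = x|_{Sᵢ} ⊕ Hit(y)ᵢ`, in the counting/advice form needed for approximate list decoding
(Healy–Vadhan–Viola 2006, Def. 5.1, Lemmas 5.2 and 5.12 = Hirahara CCC 2020, Lemma 71; Hirahara 2022,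
proof of Lemma 8.1: "for every function g that agrees with f̂ on a (1/2+ϵ)-fraction of inputs, there
exists a g-oracle program of size 2^{γn}·poly(1/ϵδ) that agrees with f on a (1−δ)-fraction of inputs"):

* hybrids `Hybᵢ(σ, ω)` between the real bits `(f(wⱼ(σ)))ⱼ` and the ideal bits `(f_M(wⱼ(σ), ωⱼ))ⱼ`
  (`hybBits`), their acceptance counts `cnt D i` for an arbitrary test `D : Seed → {0,1}ᵏ → {0,1}`,
  telescoping/pigeonhole (`exists_step_ge`);
* re-indexing the seed through "block `i` and the rest" (`overwriteX`, `sum_overwriteX`) and the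
  randomness through "position `i` and the rest" (`sum_update`), averaging over the rest
  (`exists_rest_ge`);
* **advice predictors** (`Adv`, `advPred`): a position `i`, the rest `x₀` of the seed, the Hankel seed
  `y`, a tie-break bit and, for every other position `j`, a TABLE indexed by the bits of block `i` that
  block `j` reads (`Tsub e i j`, of size `|Sᵢ ∩ Sⱼ|`) — the advice of IW97/NW reconstruction;
* `exists_advPred_ge` — **the hybrid lemma**: some advice predictor `P` satisfies
  `k · 2ᵈ |Y| |Ω|ᵏ · ∑ᵥ M(v) σ_P(v) ≥ |Ω| 2ᴺ (cnt D k - cnt D 0)` (`σ_P = ±1` correctness sign), i.e. a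
  distinguishing gap `η` per seed between all-real and all-ideal bits gives a predictor with advantage
  `≥ (η/k)`-fraction of `|Ω| 2ᴺ = 2C · 2ᴺ` on the measure `M`.

## References

* S. Hirahara, ECCC TR22-119 (2022), Lemma 8.1 and its proof [Hirahara2022PartialMCSP].
* S. Hirahara, CCC 2020, App. A, Lemma 71 ([HVV06, Lemma 5.2 and Lemma 5.12]).
* A. Healy, S. Vadhan, E. Viola, SIAM J. Comput. 35 (2006), Def. 5.1, Lemma 5.2, Lemma 5.12.
* N. Nisan, A. Wigderson, JCSS 49 (1994) (the hybrid argument with advice tables).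
-/

namespace Literature.Computability.Complexity

open Finset

namespace IWAmp

variable {N d m k : ℕ}

/-! ### Hybrids and acceptance counts -/

section Hybrid

variable (e : Fin k → (Fin N ↪ Fin d)) (idx : Fin k → Fin m → ZMod 2) (f : (Fin N → Bool) → Bool)
  (C : ℕ) (M : (Fin N → Bool) → ℕ)

/-- The `i`-th hybrid: real bits `f(wⱼ)` at positions `j < i`, ideal bits `f_M(wⱼ, ωⱼ)` at `j ≥ i`
(`Hyb₀` all ideal, `Hyb_k` all real). [cite: Hirahara2022PartialMCSP, proof of Lemma 8.1 (via Hir20a Lemma 71 / [HVV06] Def. 5.1, hybrid argument)] -/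
def hybBits (i : ℕ) (σ : Seed N d m) (ω : Fin k → Fin C × Bool) : Fin k → Bool :=
  fun j => if (j : ℕ) < i then f (inp e idx j σ) else fM C M f (inp e idx j σ) (ω j)

/-- The acceptance count of the test `D` on the `i`-th hybrid (over seeds and randomness).
[cite: Hirahara2022PartialMCSP, proof of Lemma 8.1 (hybrid argument)] -/
def cnt (D : Seed N d m → (Fin k → Bool) → Bool) (i : ℕ) : ℤ :=
  ∑ σ : Seed N d m, ∑ ω : Fin k → Fin C × Bool, b2i (D σ (hybBits e idx f C M i σ ω))

variable {e idx f C M}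

/-- **Pigeonhole over the hybrids**: some step carries a `1/k` fraction of the total gap.
[cite: Hirahara2022PartialMCSP, proof of Lemma 8.1 (hybrid argument: "there exists an index i")] -/
theorem exists_step_ge (D : Seed N d m → (Fin k → Bool) → Bool) (hk : 0 < k) :
    ∃ i : Fin k, cnt e idx f C M D k - cnt e idx f C M D 0 ≤
      k * (cnt e idx f C M D (i + 1) - cnt e idx f C M D i) := by
  have htel : ∑ i ∈ range k, (cnt e idx f C M D (i + 1) - cnt e idx f C M D i) =
      cnt e idx f C M D k - cnt e idx f C M D 0 := Finset.sum_range_sub _ _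
  have heq : ∑ _i ∈ range k, (cnt e idx f C M D k - cnt e idx f C M D 0) =
      ∑ i ∈ range k, (k : ℤ) * (cnt e idx f C M D (i + 1) - cnt e idx f C M D i) := by
    rw [sum_const, card_range, ← Finset.mul_sum, htel, nsmul_eq_mul]
  obtain ⟨i, hi, h⟩ := Finset.exists_le_of_sum_le (nonempty_range_iff.2 hk.ne') heq.le
  exact ⟨⟨i, mem_range.1 hi⟩, h⟩

end Hybrid

/-! ### Re-indexing: block `i` of the seed -/

section Overwrite

variable (e : Fin k → (Fin N ↪ Fin d))

/-- Overwrite block `i` of `x₀ ∈ {0,1}ᵈ` by `u ∈ {0,1}ᴺ`: Mathlib's `Function.extend (e i) u x₀`.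
[cite: Hirahara2022PartialMCSP, proof of Lemma 8.1 (via Hir20a Lemma 71: fixing z outside Sᵢ)] -/
noncomputable abbrev overwriteX (i : Fin k) (xo : Fin d → Bool) (u : Fin N → Bool) : Fin d → Bool :=
  Function.extend (e i) u xo

variable {e}

/-- Overwriting then reading block `i` returns the new content. [folklore] -/
theorem overwriteX_apply (i : Fin k) (xo : Fin d → Bool) (u : Fin N → Bool) (r : Fin N) :
    overwriteX e i xo u (e i r) = u r :=
  (e i).injective.extend_apply u xo r

/-- **Re-indexing the seed through block `i`** (`BlockOverwrite.sum_sum_extend`): every `x` is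
`overwrite x₀ u` for exactly `2ᴺ` pairs `(x₀, u)`. [folklore] -/
theorem sum_overwriteX (i : Fin k) (F : (Fin d → Bool) → ℤ) :
    ∑ xo : Fin d → Bool, ∑ u : Fin N → Bool, F (overwriteX e i xo u) =
      Fintype.card (Fin N → Bool) * ∑ x, F x :=
  BlockOverwrite.sum_sum_extend (e i) F

end Overwrite

/-! ### Advice predictors -/

section Advice

variable (e : Fin k → (Fin N ↪ Fin d))

/-- The positions of block `i` that block `j ≠ i` reads (those `r'` with `e i r' ∈ Sⱼ`; none for `j = i`,
whose table is never consulted); `|Tsub| ≤ |Sᵢ ∩ Sⱼ|`.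
[cite: Hirahara2022PartialMCSP, proof of Lemma 8.1 (advice indexed by z_{Sᵢ ∩ Sⱼ}, cf. Lemma 6.6)] -/
abbrev Tsub (i j : Fin k) : Type := {r' : Fin N // j ≠ i ∧ ∃ r : Fin N, e j r = e i r'}

variable (idx : Fin k → Fin m → ZMod 2)

/-- **Advice**: a position `i`, the seed outside block `i`, the Hankel seed, a tie-break bit, and for
every position `j` a table over the bits of block `i` read by block `j`.
[cite: Hirahara2022PartialMCSP, proof of Lemma 8.1 ("a g-oracle program of size 2^{γn}·poly(1/ϵδ)")] -/
abbrev Adv : Type :=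
  Σ i : Fin k, (Fin d → Bool) × Hankel.Seed N m × Bool × ((j : Fin k) → (Tsub e i j → Bool) → Bool)

variable {e idx}

/-- The seed assembled from advice and a challenge `v` placed (shifted by the hitter) on block `i`, so
that `wᵢ = v`. [cite: Hirahara2022PartialMCSP, proof of Lemma 8.1 (via Hir20a Lemma 71: one-query oracle circuit)] -/
noncomputable def advSeed (i : Fin k) (xo : Fin d → Bool) (y : Hankel.Seed N m) (v : Fin N → Bool) :
    Seed N d m :=
  (overwriteX e i xo (fun r => xor (v r) (hitB idx y i r)), y)

/-- The one-query test built from advice: position `i` gets the queried bit, the others their table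
values. [cite: Hirahara2022PartialMCSP, proof of Lemma 8.1 (via Hir20a Lemma 71)] -/
noncomputable def advTest (D : Seed N d m → (Fin k → Bool) → Bool) (a : Adv e (m := m))
    (v : Fin N → Bool) (b : Bool) : Bool :=
  D (advSeed (e := e) (idx := idx) a.1 a.2.1 a.2.2.1 v)
    fun j => if j = a.1 then b else a.2.2.2.2 j fun r' => v r'.1

/-- **The advice predictor** `P_a = pred (advTest D a) c`. [cite: Hirahara2022PartialMCSP, proof of Lemma 8.1 (via Hir20a Prop. 70 + Lemma 71)] -/
noncomputable def advPred (D : Seed N d m → (Fin k → Bool) → Bool) (a : Adv e (m := m))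
    (v : Fin N → Bool) : Bool :=
  pred (advTest (idx := idx) D a) a.2.2.2.1 v

/-- The canonical extension of a key on `Tsub e i j` to a block-`i` content. [folklore] -/
noncomputable def extKey (i j : Fin k) (key : Tsub e i j → Bool) : Fin N → Bool :=
  fun r' => if h : j ≠ i ∧ ∃ r : Fin N, e j r = e i r' then key ⟨r', h⟩ else false

/-- **Block `j` only reads the `Tsub e i j` part of the challenge**: the `j`-th input of the advice
seed is unchanged when the challenge is replaced by the canonical extension of its restriction.
[cite: Hirahara2022PartialMCSP, proof of Lemma 8.1 (via Lemma 6.6: "fⱼ(z_{Sⱼ}) … depends on z_{Sᵢ ∩ Sⱼ}")] -/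
theorem inp_advSeed_ext {i j : Fin k} (hji : j ≠ i) (xo : Fin d → Bool) (y : Hankel.Seed N m)
    (v : Fin N → Bool) :
    inp e idx j (advSeed (e := e) (idx := idx) i xo y v) =
      inp e idx j (advSeed (e := e) (idx := idx) i xo y (extKey (e := e) i j fun r' => v r'.1)) := by
  funext r
  unfold inp advSeed
  simp only
  congr 1
  simp only [overwriteX, Function.extend_def]
  by_cases h : ∃ r', e i r' = e j r
  · rw [dif_pos h, dif_pos h]
    have hmem : j ≠ i ∧ ∃ r₀ : Fin N, e j r₀ = e i (Classical.choose h) :=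
      ⟨hji, r, (Classical.choose_spec h).symm⟩
    simp only [extKey, dif_pos hmem]
  · rw [dif_neg h, dif_neg h]

end Advice

/-! ### The hybrid lemma -/

section Main

variable {e : Fin k → (Fin N ↪ Fin d)} {idx : Fin k → Fin m → ZMod 2} {f : (Fin N → Bool) → Bool}
  {C : ℕ} {M : (Fin N → Bool) → ℕ}

/-- The bits fed to `D` when position `i` carries `bi`, the positions `< i` are real and the positions
`> i` ideal with randomness `ω₀`. [cite: Hirahara2022PartialMCSP, proof of Lemma 8.1 (hybrid argument)] -/
def bitsAt (e : Fin k → (Fin N ↪ Fin d)) (idx : Fin k → Fin m → ZMod 2) (f : (Fin N → Bool) → Bool)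
    (C : ℕ) (M : (Fin N → Bool) → ℕ) (i : Fin k) (ωo : Fin k → Fin C × Bool) (σ : Seed N d m)
    (bi : Bool) : Fin k → Bool :=
  fun j => if (j : ℕ) < i then f (inp e idx j σ) else if j = i then bi else fM C M f (inp e idx j σ) (ωo j)

/-- The `(i+1)`-st hybrid is `bitsAt` with the real bit at `i`. [cite: Hirahara2022PartialMCSP, proof of Lemma 8.1 (hybrid argument)] -/
theorem hybBits_succ_update (i : Fin k) (ωo : Fin k → Fin C × Bool) (σ : Seed N d m) (o : Fin C × Bool) :
    hybBits e idx f C M (i + 1) σ (Function.update ωo i o) =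
      bitsAt e idx f C M i ωo σ (f (inp e idx i σ)) := by
  funext j
  unfold hybBits bitsAt
  rcases lt_trichotomy (j : ℕ) i with h | h | h
  · rw [if_pos (by omega), if_pos h]
  · have hj : j = i := Fin.ext h
    subst hj
    rw [if_pos (by omega), if_neg (lt_irrefl _), if_pos rfl]
  · rw [if_neg (by omega), if_neg (by omega), if_neg (fun hj => by rw [hj] at h; exact lt_irrefl _ h),
      Function.update_of_ne (fun hj => by rw [hj] at h; exact lt_irrefl _ h)]

/-- The `i`-th hybrid is `bitsAt` with the ideal bit at `i`. [cite: Hirahara2022PartialMCSP, proof of Lemma 8.1 (hybrid argument)] -/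
theorem hybBits_update (i : Fin k) (ωo : Fin k → Fin C × Bool) (σ : Seed N d m) (o : Fin C × Bool) :
    hybBits e idx f C M i σ (Function.update ωo i o) =
      bitsAt e idx f C M i ωo σ (fM C M f (inp e idx i σ) o) := by
  funext j
  unfold hybBits bitsAt
  rcases lt_trichotomy (j : ℕ) i with h | h | h
  · rw [if_pos h, if_pos h]
  · have hj : j = i := Fin.ext h
    subst hj
    rw [if_neg (lt_irrefl _), if_neg (lt_irrefl _), if_pos rfl, Function.update_self]
  · rw [if_neg (by omega), if_neg (by omega), if_neg (fun hj => by rw [hj] at h; exact lt_irrefl _ h),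
      Function.update_of_ne (fun hj => by rw [hj] at h; exact lt_irrefl _ h)]

/-- The shift `v ↦ v ⊕ Hit(y)ᵢ` as an involutive bijection. [folklore] -/
def shiftV (idx : Fin k → Fin m → ZMod 2) (y : Hankel.Seed N m) (i : Fin k) :
    (Fin N → Bool) ≃ (Fin N → Bool) where
  toFun v r := xor (v r) (hitB idx y i r)
  invFun v r := xor (v r) (hitB idx y i r)
  left_inv v := by
    funext r
    show xor (xor (v r) (hitB idx y i r)) (hitB idx y i r) = v r
    cases v r <;> cases hitB idx y i r <;> rfl
  right_inv v := by
    funext r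
    show xor (xor (v r) (hitB idx y i r)) (hitB idx y i r) = v r
    cases v r <;> cases hitB idx y i r <;> rfl

/-- The challenge sits on block `i`: `wᵢ(advSeed v) = v`. [folklore] -/
theorem inp_advSeed_self (i : Fin k) (xo : Fin d → Bool) (y : Hankel.Seed N m) (v : Fin N → Bool) :
    inp e idx i (advSeed (e := e) (idx := idx) i xo y v) = v := by
  funext r
  unfold inp advSeed
  simp only
  rw [overwriteX_apply]
  cases v r <;> cases hitB idx y i r <;> rfl

/-- **The hybrid lemma with advice** (HVV Lemma 5.2/5.12; Hir20a Lemma 71, counting form). For any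
test `D` on (seed, `k` bits), capped `M ≤ C` and `k ≥ 1`, some advice predictor `P = advPred D a`
satisfies `|Ω| 2ᴺ (cnt D k - cnt D 0) ≤ k · 2ᵈ |Y| |Ω|ᵏ · ∑ᵥ M(v) σ_P(v)`: the gap between the
all-real and the all-ideal hybrid is paid for, at some position `i` and for some fixing of everything
but block `i` and its randomness, by a one-query distinguisher between `(v, f v)` and `(v, f_M(v))`
whose other bits are table look-ups, hence (Prop. 70) by a predictor with advantage on `M`.
[cite: Hirahara2022PartialMCSP, proof of Lemma 8.1 (via Hir20a Lemma 71 = [HVV06] Lemmas 5.2, 5.12)] -/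
theorem exists_advPred_ge (hM : ∀ v, M v ≤ C) (hC : 0 < C) (hk : 0 < k)
    (D : Seed N d m → (Fin k → Bool) → Bool) :
    ∃ a : Adv e (m := m),
      (Fintype.card (Fin C × Bool) : ℤ) * Fintype.card (Fin N → Bool) *
          (cnt e idx f C M D k - cnt e idx f C M D 0) ≤
        k * (Fintype.card (Fin d → Bool) * Fintype.card (Hankel.Seed N m) *
            Fintype.card (Fin k → Fin C × Bool)) *
          ∑ v, (M v : ℤ) * HardCore.sgn f (advPred (idx := idx) D a) v := by
  classical
  -- Step 1: a heavy step `i`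
  obtain ⟨i, hi⟩ := exists_step_ge (e := e) (idx := idx) (f := f) (C := C) (M := M) D hk
  set Δ := cnt e idx f C M D (i + 1) - cnt e idx f C M D i with hΔ
  -- the summand of the step, as a function of (seed, randomness)
  set g : Seed N d m → (Fin k → Fin C × Bool) → ℤ := fun σ ω =>
    b2i (D σ (hybBits e idx f C M (i + 1) σ ω)) - b2i (D σ (hybBits e idx f C M i σ ω)) with hg
  have hΔg : Δ = ∑ σ, ∑ ω, g σ ω := by
    simp only [hΔ, cnt, hg, Finset.sum_sub_distrib]
  -- Step 2: re-index through block `i` and position `i`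
  set inner : (Fin d → Bool) × Hankel.Seed N m × (Fin k → Fin C × Bool) → ℤ := fun t =>
    ∑ u : Fin N → Bool, ∑ o : Fin C × Bool, g (overwriteX e i t.1 u, t.2.1) (Function.update t.2.2 i o)
    with hinner
  have hsum : (Fintype.card (Fin C × Bool) : ℤ) * Fintype.card (Fin N → Bool) * Δ = ∑ t, inner t := by
    rw [hΔg, Fintype.sum_prod_type]
    -- seed re-indexing
    have h1 := sum_overwriteX (e := e) i (fun x => ∑ y : Hankel.Seed N m, ∑ ω, g (x, y) ω)
    -- randomness re-indexing, inside
    have h2 : ∀ (xo : Fin d → Bool) (u : Fin N → Bool) (y : Hankel.Seed N m),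
        ∑ ωo : Fin k → Fin C × Bool, ∑ o, g (overwriteX e i xo u, y) (Function.update ωo i o) =
          Fintype.card (Fin C × Bool) * ∑ ω, g (overwriteX e i xo u, y) ω :=
      fun xo u y => BlockOverwrite.sum_sum_update i _
    calc (Fintype.card (Fin C × Bool) : ℤ) * Fintype.card (Fin N → Bool) *
          ∑ x : Fin d → Bool, ∑ y : Hankel.Seed N m, ∑ ω, g (x, y) ω
        = Fintype.card (Fin C × Bool) *
            ∑ xo : Fin d → Bool, ∑ u : Fin N → Bool, ∑ y : Hankel.Seed N m,
              ∑ ω, g (overwriteX e i xo u, y) ω := by rw [h1]; ring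
      _ = ∑ xo : Fin d → Bool, ∑ u : Fin N → Bool, ∑ y : Hankel.Seed N m,
            ∑ ωo : Fin k → Fin C × Bool, ∑ o, g (overwriteX e i xo u, y) (Function.update ωo i o) := by
          simp only [Finset.mul_sum, h2]
      _ = ∑ t, inner t := by
          simp only [hinner, Fintype.sum_prod_type]
          refine Finset.sum_congr rfl fun xo _ => ?_
          rw [Finset.sum_comm]
          refine Finset.sum_congr rfl fun y _ => ?_
          rw [Finset.sum_comm]
          refine Finset.sum_congr rfl fun ωo _ => ?_
          exact Finset.sum_comm
  -- Step 3: fix the rest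
  haveI : Nonempty (Fin C × Bool) := ⟨(⟨0, hC⟩, false)⟩
  haveI : Nonempty ((Fin d → Bool) × Hankel.Seed N m × (Fin k → Fin C × Bool)) := inferInstance
  obtain ⟨⟨xo, y, ωo⟩, hrest⟩ := BlockOverwrite.exists_sum_le_card_nsmul inner
  rw [nsmul_eq_mul] at hrest
  -- Step 4/5: the inner sum as a one-query gap
  set A : (Fin N → Bool) → Bool → Bool := fun v bi =>
    D (advSeed (e := e) (idx := idx) i xo y v) (bitsAt e idx f C M i ωo (advSeed (e := e) (idx := idx) i xo y v) bi)
    with hA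
  have hinnerA : inner (xo, y, ωo) =
      2 * C * ∑ v, b2i (A v (f v)) - ∑ v, ∑ o : Fin C × Bool, b2i (A v (fM C M f v o)) := by
    simp only [hinner, hg]
    -- reindex `u = shiftV v`
    rw [← Equiv.sum_comp (shiftV idx y i) _]
    have hσ : ∀ v, (overwriteX e i xo (shiftV idx y i v), y) = advSeed (e := e) (idx := idx) i xo y v :=
      fun v => rfl
    simp only [hσ, hybBits_succ_update, hybBits_update, inp_advSeed_self, Finset.sum_sub_distrib,
      sum_const, card_univ, Fintype.card_prod, Fintype.card_fin, Fintype.card_bool, nsmul_eq_mul,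
      Finset.mul_sum]
    push_cast
    simp only [hA]
    ring_nf
  -- Step 6/7: Prop. 70
  rw [gap_eq hM A f] at hinnerA
  obtain ⟨c, hc⟩ := exists_pred_adv_ge M A f
  -- Step 8: `A` is the advice test of `a = ⟨i, xo, y, c, true tables⟩`
  set tab : (j : Fin k) → (Tsub e i j → Bool) → Bool := fun j key =>
    if (j : ℕ) < i then f (inp e idx j (advSeed (e := e) (idx := idx) i xo y (extKey (e := e) i j key)))
    else fM C M f (inp e idx j (advSeed (e := e) (idx := idx) i xo y (extKey (e := e) i j key))) (ωo j)
    with htab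
  set a : Adv e (m := m) := ⟨i, xo, y, c, tab⟩ with ha
  have hAa : ∀ v bi, A v bi = advTest (idx := idx) D a v bi := by
    intro v bi
    change D (advSeed (e := e) (idx := idx) i xo y v)
        (bitsAt e idx f C M i ωo (advSeed (e := e) (idx := idx) i xo y v) bi) =
      D (advSeed (e := e) (idx := idx) i xo y v) (fun j => if j = i then bi else tab j fun r' => v r'.1)
    congr 1
    funext j
    unfold bitsAt
    by_cases hji : j = i
    · subst hji; simp
    · rw [if_neg hji]
      rcases Nat.lt_or_ge j i with hlt | hge
      · rw [if_pos hlt, htab]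
        simp only
        rw [if_pos hlt, ← inp_advSeed_ext hji, if_neg hji]
      · have hne : ¬((j : ℕ) < i) := by omega
        rw [if_neg hne, if_neg hji, htab]
        simp only
        rw [if_neg hne, ← inp_advSeed_ext hji]
  have hAfun : A = advTest (idx := idx) D a := funext fun v => funext fun bi => hAa v bi
  refine ⟨a, ?_⟩
  have hpred : pred A c = advPred (idx := idx) D a := by
    funext v; rw [hAfun]; rfl
  -- assemble the inequalities
  have hcard : (Fintype.card ((Fin d → Bool) × Hankel.Seed N m × (Fin k → Fin C × Bool)) : ℤ) =
      Fintype.card (Fin d → Bool) * Fintype.card (Hankel.Seed N m) * Fintype.card (Fin k → Fin C × Bool) := by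
    rw [Fintype.card_prod, Fintype.card_prod]; push_cast; ring
  have hR : 0 ≤ (Fintype.card (Fin d → Bool) : ℤ) * Fintype.card (Hankel.Seed N m) *
      Fintype.card (Fin k → Fin C × Bool) := by positivity
  have hΩ : 0 ≤ (Fintype.card (Fin C × Bool) : ℤ) * Fintype.card (Fin N → Bool) := by positivity
  have h3 : ∑ t, inner t ≤ Fintype.card (Fin d → Bool) * Fintype.card (Hankel.Seed N m) *
      Fintype.card (Fin k → Fin C × Bool) * inner (xo, y, ωo) := by rw [← hcard]; exact hrest
  have h4 : inner (xo, y, ωo) ≤ ∑ v, (M v : ℤ) * HardCore.sgn f (advPred (idx := idx) D a) v := by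
    rw [hinnerA, ← hpred]; exact hc
  calc (Fintype.card (Fin C × Bool) : ℤ) * Fintype.card (Fin N → Bool) *
        (cnt e idx f C M D k - cnt e idx f C M D 0)
      ≤ (Fintype.card (Fin C × Bool) : ℤ) * Fintype.card (Fin N → Bool) * (k * Δ) :=
        mul_le_mul_of_nonneg_left hi hΩ
    _ = k * ((Fintype.card (Fin C × Bool) : ℤ) * Fintype.card (Fin N → Bool) * Δ) := by ring
    _ = k * ∑ t, inner t := by rw [hsum]
    _ ≤ k * (Fintype.card (Fin d → Bool) * Fintype.card (Hankel.Seed N m) *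
          Fintype.card (Fin k → Fin C × Bool) * inner (xo, y, ωo)) :=
        mul_le_mul_of_nonneg_left h3 (by positivity)
    _ ≤ k * (Fintype.card (Fin d → Bool) * Fintype.card (Hankel.Seed N m) *
          Fintype.card (Fin k → Fin C × Bool) * ∑ v, (M v : ℤ) * HardCore.sgn f (advPred (idx := idx) D a) v) :=
        mul_le_mul_of_nonneg_left (mul_le_mul_of_nonneg_left h4 hR) (by positivity)
    _ = _ := by ring

end Main

/-! ### The size of the advice -/

section AdviceCard

variable {e : Fin k → (Fin N ↪ Fin d)}

/-- Under the design property (pairwise block intersections `≤ ρ`, i.e. `IsNWDesign ρ e` of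
`NWGenerator.lean`, unfolded to keep this file's imports light), block `j ≠ i` reads at most `ρ`
positions of block `i`. [cite: Hirahara2022PartialMCSP, Prop. 6.2 and proof of Lemma 8.1 (|Sᵢ ∩ Sⱼ| ≤ ρ = γn)] -/
theorem card_Tsub_le {ρ : ℕ} (hdes : ∀ ⦃i j : Fin k⦄, i ≠ j → (univ.map (e i) ∩ univ.map (e j)).card ≤ ρ)
    (i j : Fin k) : Fintype.card (Tsub e i j) ≤ ρ := by
  classical
  by_cases hji : j = i
  · have : IsEmpty (Tsub e i j) := ⟨fun r' => r'.2.1 hji⟩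
    rw [Fintype.card_eq_zero]; exact Nat.zero_le _
  · -- inject `Tsub e i j` into `Sᵢ ∩ Sⱼ` by `r' ↦ e i r'`
    have hinj : Function.Injective fun r' : Tsub e i j =>
        (⟨e i r'.1, by
          rw [mem_inter, mem_map, mem_map]
          obtain ⟨r, hr⟩ := r'.2.2
          exact ⟨⟨r'.1, mem_univ _, rfl⟩, ⟨r, mem_univ _, hr⟩⟩⟩ :
          ((univ.map (e i) ∩ univ.map (e j) : Finset (Fin d)))) := by
      intro a b hab
      have := congrArg (fun x : ((univ.map (e i) ∩ univ.map (e j) : Finset (Fin d))) => (x : Fin d)) hab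
      exact Subtype.ext ((e i).injective this)
    have h := Fintype.card_le_of_injective _ hinj
    rw [Fintype.card_coe] at h
    exact h.trans (hdes (Ne.symm hji))

/-- **Size of the advice** (the "program of size `2^{γn}·poly(1/ϵδ)`"): with intersections `≤ ρ`,
`|Adv| ≤ k · 2ᵈ · |Y| · 2 · 2^{k·2^ρ}`. [cite: Hirahara2022PartialMCSP, Lemma 8.1 (list-decodability: advice 2^{γn}·poly(1/ϵδ))] -/
theorem card_Adv_le {ρ : ℕ} (hdes : ∀ ⦃i j : Fin k⦄, i ≠ j → (univ.map (e i) ∩ univ.map (e j)).card ≤ ρ) :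
    Fintype.card (Adv e (m := m)) ≤
      k * (2 ^ d * Fintype.card (Hankel.Seed N m) * 2 * 2 ^ (k * 2 ^ ρ)) := by
  classical
  rw [Fintype.card_sigma]
  calc ∑ i : Fin k, Fintype.card ((Fin d → Bool) × Hankel.Seed N m × Bool ×
          ((j : Fin k) → (Tsub e i j → Bool) → Bool))
      ≤ ∑ _i : Fin k, 2 ^ d * Fintype.card (Hankel.Seed N m) * 2 * 2 ^ (k * 2 ^ ρ) :=
        sum_le_sum fun i _ => by
          have h1 := Fintype.card_prod (Fin d → Bool)
            (Hankel.Seed N m × Bool × ((j : Fin k) → (Tsub e i j → Bool) → Bool))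
          have h2 := Fintype.card_prod (Hankel.Seed N m) (Bool × ((j : Fin k) → (Tsub e i j → Bool) → Bool))
          have h3 := Fintype.card_prod Bool ((j : Fin k) → (Tsub e i j → Bool) → Bool)
          have hd : Fintype.card (Fin d → Bool) = 2 ^ d := by simp
          rw [h1, h2, h3, hd, Fintype.card_bool, Fintype.card_pi]
          have htab : ∏ j : Fin k, Fintype.card ((Tsub e i j → Bool) → Bool) ≤ 2 ^ (k * 2 ^ ρ) := by
            calc ∏ j : Fin k, Fintype.card ((Tsub e i j → Bool) → Bool)
                ≤ ∏ _j : Fin k, 2 ^ (2 ^ ρ) := Finset.prod_le_prod' fun j _ => by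
                    rw [Fintype.card_fun, Fintype.card_fun, Fintype.card_bool]
                    exact Nat.pow_le_pow_right (by norm_num)
                      (Nat.pow_le_pow_right (by norm_num) (card_Tsub_le hdes i j))
              _ = 2 ^ (k * 2 ^ ρ) := by rw [prod_const, card_univ, Fintype.card_fin, ← pow_mul, mul_comm]
          calc 2 ^ d * (Fintype.card (Hankel.Seed N m) *
                (2 * ∏ j : Fin k, Fintype.card ((Tsub e i j → Bool) → Bool)))
              ≤ 2 ^ d * (Fintype.card (Hankel.Seed N m) * (2 * 2 ^ (k * 2 ^ ρ))) := by gcongr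
            _ = 2 ^ d * Fintype.card (Hankel.Seed N m) * 2 * 2 ^ (k * 2 ^ ρ) := by ring
    _ = k * (2 ^ d * Fintype.card (Hankel.Seed N m) * 2 * 2 ^ (k * 2 ^ ρ)) := by
        rw [sum_const, card_univ, Fintype.card_fin, smul_eq_mul]

end AdviceCard

/-! ### Approximate list decoding of `Amp` -/

section ListDecoding

variable {e : Fin k → (Fin N ↪ Fin d)} {idx : Fin k → Fin m → ZMod 2} {f : (Fin N → Bool) → Bool}

/-- The test "does the received word agree with the XOR of the given bits": `D_G(σ, b) = [G σ = ⊕ b]`.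
[cite: Hirahara2022PartialMCSP, proof of Lemma 8.1 (a function g that agrees with f̂)] -/
def agreeTest (G : Seed N d m → Bool) (σ : Seed N d m) (bits : Fin k → Bool) : Bool :=
  G σ == parityFin k bits

/-- `[a == b]` as an `if`. [folklore] -/
theorem b2i_beq (a b : Bool) : b2i (a == b) = if b = a then 1 else 0 := by
  cases a <;> cases b <;> rfl

/-- `cnt_k` counts agreements with `Amp^f`: `cnt D_G k = |Ω|ᵏ · #{σ | G σ = Amp^f(σ)}`. [cite: Hirahara2022PartialMCSP, proof of Lemma 8.1] -/
theorem cnt_real (G : Seed N d m → Bool) (C : ℕ) (M : (Fin N → Bool) → ℕ) :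
    cnt e idx f C M (agreeTest G) k =
      Fintype.card (Fin k → Fin C × Bool) *
        ((univ.filter fun σ : Seed N d m => G σ = amp e idx f σ).card : ℤ) := by
  unfold cnt
  have hk : ∀ σ (ω : Fin k → Fin C × Bool), hybBits e idx f C M k σ ω = fun j => f (inp e idx j σ) := by
    intro σ ω; funext j; simp [hybBits, j.isLt]
  simp_rw [hk, agreeTest, sum_const, card_univ, nsmul_eq_mul]
  rw [← Finset.mul_sum]
  congr 1
  simp_rw [b2i_beq]
  rw [Finset.sum_boole]
  rw [Finset.filter_congr (s := (univ : Finset (Seed N d m)))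
    (q := fun σ => G σ = amp e idx f σ) (fun σ _ => by
      rw [amp]; exact ⟨fun h => h.symm, fun h => h.symm⟩)]

/-- `cnt₀` is bounded by the expected bias: `2 · cnt D_G 0 ≤ (2C)ᵏ (|Seed| + ∑_σ ∏ᵢ (1 - M(wᵢ(σ))/C))`.
[cite: Hirahara2022PartialMCSP, proof of Lemma 8.1 (via [HVV06] Lemma 3.4: "½ + ½ ExpBias")] -/
theorem two_mul_cnt_ideal_le (G : Seed N d m → Bool) {C : ℕ} (hC : 0 < C) {M : (Fin N → Bool) → ℕ}
    (hM : ∀ v, M v ≤ C) :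
    (2 * cnt e idx f C M (agreeTest G) 0 : ℝ) ≤
      (2 * C : ℝ) ^ k * (Fintype.card (Seed N d m) +
        ∑ σ : Seed N d m, ∏ i, (1 - (M (inp e idx i σ) : ℝ) / C)) := by
  have hCR : (0 : ℝ) < C := by exact_mod_cast hC
  unfold cnt
  have h0 : ∀ σ (ω : Fin k → Fin C × Bool), hybBits e idx f C M 0 σ ω =
      fun j => fM C M f (inp e idx j σ) (ω j) := by
    intro σ ω; funext j; simp [hybBits]
  simp_rw [h0, agreeTest]
  -- per seed
  have hσ : ∀ σ : Seed N d m,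
      (2 * (∑ ω : Fin k → Fin C × Bool,
          b2i (G σ == parityFin k fun j => fM C M f (inp e idx j σ) (ω j)) : ℤ) : ℝ)
        ≤ (2 * C : ℝ) ^ k * (1 + ∏ i, (1 - (M (inp e idx i σ) : ℝ) / C)) := by
    intro σ
    have h := two_mul_card_parity_fM_le (k := k) hM f (fun i => inp e idx i σ) (G σ)
    have hsum : ∑ ω : Fin k → Fin C × Bool, b2i (G σ == parityFin k fun j => fM C M f (inp e idx j σ) (ω j)) =
        ((univ.filter fun ω : Fin k → Fin C × Bool =>
          parityFin k (fun i => fM C M f (inp e idx i σ) (ω i)) = G σ).card : ℤ) := by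
      simp_rw [b2i_beq]
      rw [Finset.sum_boole]
    rw [hsum]
    have h' : (2 * ((univ.filter fun ω : Fin k → Fin C × Bool =>
        parityFin k (fun i => fM C M f (inp e idx i σ) (ω i)) = G σ).card : ℤ) : ℝ) ≤
        (((2 * C : ℤ) ^ k + ∏ i, (2 * (C - M (inp e idx i σ)) : ℤ) : ℤ) : ℝ) := by exact_mod_cast h
    push_cast at h' ⊢
    have hprod : ∏ i, (2 * ((C : ℝ) - (M (inp e idx i σ) : ℝ))) =
        (2 * C : ℝ) ^ k * ∏ i, (1 - (M (inp e idx i σ) : ℝ) / C) := by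
      have hfac : ∀ i, 2 * ((C : ℝ) - (M (inp e idx i σ) : ℝ)) =
          (2 * C : ℝ) * (1 - (M (inp e idx i σ) : ℝ) / C) := fun i => by
        field_simp
      simp_rw [hfac]
      rw [Finset.prod_mul_distrib, Finset.prod_const, card_univ, Fintype.card_fin]
    rw [hprod] at h'
    linarith
  calc (2 * (∑ σ : Seed N d m, ∑ ω : Fin k → Fin C × Bool,
          b2i (G σ == parityFin k fun j => fM C M f (inp e idx j σ) (ω j)) : ℤ) : ℝ)
      = ∑ σ : Seed N d m, (2 * (∑ ω : Fin k → Fin C × Bool,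
          b2i (G σ == parityFin k fun j => fM C M f (inp e idx j σ) (ω j)) : ℤ) : ℝ) := by
        push_cast; rw [Finset.mul_sum]
    _ ≤ ∑ σ : Seed N d m, (2 * C : ℝ) ^ k * (1 + ∏ i, (1 - (M (inp e idx i σ) : ℝ) / C)) :=
        sum_le_sum fun σ _ => hσ σ
    _ = (2 * C : ℝ) ^ k * (Fintype.card (Seed N d m) +
          ∑ σ : Seed N d m, ∏ i, (1 - (M (inp e idx i σ) : ℝ) / C)) := by
        rw [← Finset.mul_sum, Finset.sum_add_distrib, sum_const, card_univ, nsmul_eq_mul, mul_one]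

/-- **Approximate list decoding of the IW code** (Hirahara 2022, Lemma 8.1, list-decodability, in
counting form; Hir20a Thm. 56 / Cor. 73 + Lemma 74). Let the indexing of the hitter be injective,
`k ε δ ≥ 6` and `C ε δ ≥ 2k`. If a received word `G` agrees with `Amp^f` on a `(1/2 + ε)` fraction of
the seeds, then `f` is computed, on all but a `δ` fraction of `{0,1}ᴺ`, by the majority vote of at
most `C²` ADVICE PREDICTORS `advPred D_G a` — functions determined by `G` and a short advice `a`
(a position, a seed rest, a Hankel seed, a bit, and `k` tables of `2^{|Sᵢ ∩ Sⱼ|}` bits). So the code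
`f ↦ Amp^f` is approximately list-decodable with list size `|Adv|^{C²}`.
[cite: Hirahara2022PartialMCSP, Lemma 8.1 (list-decodability: "a g-oracle program of size 2^{γn}·poly(1/ϵδ) that agrees with f on a (1−δ)-fraction of inputs")] -/
theorem exists_majority_advPred (hidx : Function.Injective idx) {ε δ : ℝ} (hε : 0 < ε) (hδ : 0 < δ)
    (hkεδ : 6 ≤ k * ε * δ) {C : ℕ} (hCεδ : 2 * k ≤ C * ε * δ) (G : Seed N d m → Bool)
    (hagree : (1 / 2 + ε) * Fintype.card (Seed N d m) ≤
      ((univ.filter fun σ : Seed N d m => G σ = amp e idx f σ).card : ℝ)) :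
    ∃ (T : ℕ) (advs : ℕ → Adv e (m := m)), T ≤ C ^ 2 ∧
      (((univ : Finset (Fin N → Bool)).filter fun v =>
          HardCore.margin f (fun j => advPred (idx := idx) (agreeTest G) (advs j)) T v ≤ 0).card : ℝ) <
        δ * Fintype.card (Fin N → Bool) := by
  have hk : 0 < k := by
    rcases Nat.eq_zero_or_pos k with rfl | hk
    · simp at hkεδ; linarith
    · exact hk
  have hkR : (0 : ℝ) < k := by exact_mod_cast hk
  have hC : 0 < C := by
    rcases Nat.eq_zero_or_pos C with rfl | hC
    · simp at hCεδ; linarith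
    · exact hC
  have hCR : (0 : ℝ) < C := by exact_mod_cast hC
  -- the hard-core lemma with the class of advice predictors, cap `C`, advantage `ε / k`
  set Cls : Set ((Fin N → Bool) → Bool) := Set.range (advPred (e := e) (idx := idx) (agreeTest G)) with hCls
  have hγ : (0 : ℝ) ≤ ε / k := by positivity
  have hKγδ : 2 ≤ (C : ℝ) * (ε / k) * δ := by
    rw [show (C : ℝ) * (ε / k) * δ = C * ε * δ / k by ring, le_div_iff₀ hkR]
    linarith
  have hyp : ∀ M' : (Fin N → Bool) → ℤ, (∀ x, 0 ≤ M' x ∧ M' x ≤ C) → HardCore.Dense C δ M' →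
      ∃ Q, HardCore.Weak (ε / k) f Cls M' Q := by
    intro M' hM' hdense
    set M : (Fin N → Bool) → ℕ := fun v => (M' v).toNat with hMdef
    have hMM : ∀ v, (M v : ℤ) = M' v := fun v => Int.toNat_of_nonneg (hM' v).1
    have hM : ∀ v, M v ≤ C := fun v => by
      have := (hM' v).2; rw [← hMM v] at this; exact_mod_cast this
    obtain ⟨a, ha⟩ := exists_advPred_ge (e := e) (idx := idx) (f := f) hM hC hk (agreeTest G)
    refine ⟨advPred (idx := idx) (agreeTest G) a, ⟨a, rfl⟩, ?_⟩
    -- translate `ha` to reals and compare with the bounds on `cnt_k`, `cnt₀`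
    unfold HardCore.Dense HardCore.mass at hdense
    unfold HardCore.advOn HardCore.mass
    simp_rw [← hMM] at hdense ⊢
    push_cast at hdense ⊢
    have hdense' : δ * C * Fintype.card (Fin N → Bool) ≤ ∑ v, (M v : ℝ) := hdense
    -- real form of `ha`
    have haR : (Fintype.card (Fin C × Bool) : ℝ) * Fintype.card (Fin N → Bool) *
        ((cnt e idx f C M (agreeTest G) k : ℝ) - cnt e idx f C M (agreeTest G) 0) ≤
        k * (Fintype.card (Fin d → Bool) * Fintype.card (Hankel.Seed N m) *
          Fintype.card (Fin k → Fin C × Bool)) * ∑ v, (M v : ℝ) * HardCore.sgn f (advPred (idx := idx) (agreeTest G) a) v := by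
      exact_mod_cast ha
    -- bounds on the counts
    have hreal : (cnt e idx f C M (agreeTest G) k : ℝ) ≥
        (2 * C : ℝ) ^ k * ((1 / 2 + ε) * Fintype.card (Seed N d m)) := by
      have h := cnt_real (e := e) (idx := idx) (f := f) G C M
      have h' : (cnt e idx f C M (agreeTest G) k : ℝ) = Fintype.card (Fin k → Fin C × Bool) *
          ((univ.filter fun σ : Seed N d m => G σ = amp e idx f σ).card : ℝ) := by exact_mod_cast h
      rw [h', Fintype.card_fun, Fintype.card_prod, Fintype.card_fin, Fintype.card_bool, Fintype.card_fin]
      push_cast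
      rw [show ((C : ℝ) * 2) = 2 * C by ring]
      exact mul_le_mul_of_nonneg_left hagree (by positivity)
    have hideal := two_mul_cnt_ideal_le (e := e) (idx := idx) (f := f) G hC hM
    have hexp := sum_prod_one_sub_le e hidx hC hM hδ hk hdense'
    -- combine: `cnt_k - cnt₀ ≥ (2C)^k |Seed| (ε - 3/(kδ)) ≥ (2C)^k |Seed| ε/2`
    set S := (Fintype.card (Seed N d m) : ℝ) with hS
    have hS0 : 0 < S := by rw [hS]; exact_mod_cast Fintype.card_pos
    have hP : (0 : ℝ) < (2 * C : ℝ) ^ k := by positivity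
    have hdiff : (2 * C : ℝ) ^ k * (S * ε / 2) ≤
        (cnt e idx f C M (agreeTest G) k : ℝ) - cnt e idx f C M (agreeTest G) 0 := by
      have h3 : 6 * S / (k * δ) ≤ S * ε := by
        rw [div_le_iff₀ (by positivity)]; nlinarith
      nlinarith
    -- the cardinalities: `|Ω| = 2C`, `|{0,1}ᴺ|`, `2ᵈ |Y| |Ωᵏ| = S (2C)^k`
    have hΩ : (Fintype.card (Fin C × Bool) : ℝ) = 2 * C := by
      rw [Fintype.card_prod, Fintype.card_fin, Fintype.card_bool]; push_cast; ring
    have hΩk : (Fintype.card (Fin k → Fin C × Bool) : ℝ) = (2 * C : ℝ) ^ k := by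
      rw [Fintype.card_fun, Fintype.card_prod, Fintype.card_fin, Fintype.card_bool, Fintype.card_fin]
      push_cast; ring
    have hSeed : (Fintype.card (Fin d → Bool) : ℝ) * Fintype.card (Hankel.Seed N m) = S := by
      rw [hS]; exact_mod_cast (Fintype.card_prod _ _).symm
    set V := (Fintype.card (Fin N → Bool) : ℝ) with hV
    have hV0 : 0 < V := by rw [hV]; exact_mod_cast Fintype.card_pos
    set Adv' := ∑ v, (M v : ℝ) * HardCore.sgn f (advPred (idx := idx) (agreeTest G) a) v with hAdv
    rw [hΩ, hΩk, hSeed] at haR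
    -- `2C V (2C)^k S ε / 2 ≤ k S (2C)^k Adv'`, hence `C V ε / k ≤ Adv'`
    have h1 : 2 * C * V * ((2 * C : ℝ) ^ k * (S * ε / 2)) ≤ k * (S * (2 * C : ℝ) ^ k) * Adv' :=
      (mul_le_mul_of_nonneg_left hdiff (by positivity)).trans haR
    have h2 : C * V * ε ≤ k * Adv' := by
      have hpos : (0 : ℝ) < (2 * C : ℝ) ^ k * S := by positivity
      have : (C * V * ε - k * Adv') * ((2 * C : ℝ) ^ k * S) ≤ 0 := by nlinarith
      nlinarith
    -- and `∑ M ≤ C V`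
    have hmass : ∑ v, (M v : ℝ) ≤ C * V := by
      calc ∑ v, (M v : ℝ) ≤ ∑ _v : Fin N → Bool, (C : ℝ) := sum_le_sum fun v _ => by exact_mod_cast hM v
        _ = C * V := by rw [sum_const, card_univ, nsmul_eq_mul, hV]; ring
    calc ε / k * ∑ v, (M v : ℝ) ≤ ε / k * (C * V) := mul_le_mul_of_nonneg_left hmass hγ
      _ = (C * V * ε) / k := by ring
      _ ≤ Adv' := by rw [div_le_iff₀ hkR]; linarith
  obtain ⟨T, P, hT, hPmem, hcount⟩ := HardCore.exists_majority_correct (U := Fin N → Bool) hγ hKγδ hyp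
  -- choose advice for each used predictor
  have hchoice : ∀ j, ∃ a : Adv e (m := m), j < T → advPred (idx := idx) (agreeTest G) a = P j := by
    intro j
    by_cases hj : j < T
    · obtain ⟨a, ha⟩ := hPmem j hj
      exact ⟨a, fun _ => ha⟩
    · exact ⟨⟨⟨0, hk⟩, fun _ => false, (0, 0), false, fun _ _ => false⟩, fun h => absurd h hj⟩
  choose advs hadvs using hchoice
  refine ⟨T, advs, hT, ?_⟩
  have hmargin : ∀ v, HardCore.margin f (fun j => advPred (idx := idx) (agreeTest G) (advs j)) T v =
      HardCore.margin f P T v := fun v =>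
    HardCore.margin_congr f (fun j hj => hadvs j hj) v
  simp_rw [hmargin]
  exact hcount

end ListDecoding

end IWAmp

end Literature.Computability.Complexity
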